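import Mathlib
import Summits.KontsevichZagierPeriods.Zeta5Search.Families.GapGaugeCyclic
import Summits.KontsevichZagierPeriods.Zeta5Search.Families.VIMGaugeInvariance
import Summits.KontsevichZagierPeriods.Zeta5Search.Families.DualConstantTerm
import Summits.KontsevichZagierPeriods.Zeta5Search.Families.CellularBrownZudilinSymmetry
import Summits.KontsevichZagierPeriods.Zeta5Search.Families.DualExactFullCone
import HarnessLib

/-!
# ζ(5) search — Families: Brown–Zudilin's leading coefficient is INVARIANT under the hidden involution `bzSwap`

HONEST FRAMING: systematic search; no irrationality claim unless certified.  Cell `pub-zeta5`, seat P2 g10 (Families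
layer), 2026-08-23.  Identities between integers (coefficients of integer polynomials; Brown–Zudilin's leading
coefficient `Q(a)` of [BrownZudilin2022, (17)]); nothing about the arithmetic of `ζ(5)`; no record moves; no
conjecture node is used (cert-2 g8's THEOREM `DualR.leadingCoeffIsDualConstantTerm_holds`, the former conjecture
D-exact of `Families/DualConstantTerm`, is used as a theorem).

P2 g4 (`Families/CellularBrownZudilinSymmetry`) found the non-trivial dihedral symmetry of the seating `₈π₈^∨` and the
induced involution `bzSwap (a₁,…,a₈) = (a₅,a₄,a₃,a₂,a₁,a₇,a₆,a₄+a₇+a₈−a₂−a₆)` of Brown–Zudilin's parameters, under which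
the GROWTH constant is invariant (`bzSup_bzSwap`).  Here the EXACT counterpart: `bzSwap` acts on the dual cell as
"positions shifted by `4`" (`bzDen_bzSwap`, `bzNum_bzSwap`), i.e. it moves the point at infinity of P2 g6's dual gauge
from position `7` to position `3` of the SAME cyclic configuration; by the gauge independence of the dual gap constant
term (`Families/GapGaugeCyclic`, `GapRegime.gaugeCT_eq_gauge_zero`):
* **`dualConstantTerm_bzSwap`**: `dualConstantTerm (bzSwap a) = dualConstantTerm a` whenever `bzNum a, bzDen a ≥ 0`;
* **`abs_QOf_bzSwap`**: `|Q(bzSwap a)| = |Q(a)|` on the same cone — an exact symmetry of Brown–Zudilin's leading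
  coefficients (with cert-2 g8's D-exact theorem).
The cyclic datum of `a`: sides `B x = bzDen a x` (positions `x : Fin 8` of `₈π₈^∨ = pi8dual`), chords `A x y` = the
`δ⁰`-edge exponent `bzNum a k` when the labels `pi8dual x, pi8dual y` are `{k, k+1}`; its balance is Brown's homogeneity
`homogeneous_bz`.  Standard axioms only.
-/

noncomputable section

namespace Summit.KontsevichZagierPeriods.Zeta5Search.Families.Cellular

namespace BZSwapCT

open MvPolynomial Finset GapRegime
open Literature.NumberTheory.Irrationality

/-- The label of a position of `₈π₈^∨` as a natural number (`pi8dual = (7,1,3,0,6,4,2,5)`, read with `List.getD`). -/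
def lab (n : ℕ) : ℕ := ([7, 1, 3, 0, 6, 4, 2, 5] : List ℕ).getD n 0

/-- The chord multiplicities of the dual cyclic configuration of `₈π₈^∨` with exponents `a`: positions `x, y` are joined
by the `δ⁰`-edge `{k, k+1}` (exponent `bzNum a k`) when their labels are `k`, `k+1` (mod `8`). -/
def A (a : Fin 8 → ℤ) (x y : Fin 8) : ℕ :=
  if lab y.val = (lab x.val + 1) % 8 then (bzNum a ⟨lab x.val % 8, Nat.mod_lt _ (by norm_num)⟩).toNat
  else if lab x.val = (lab y.val + 1) % 8 then (bzNum a ⟨lab y.val % 8, Nat.mod_lt _ (by norm_num)⟩).toNat else 0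

/-- The side multiplicities: `B x = bzDen a x` on the side between the positions `x` and `x + 1`. -/
def B (a : Fin 8 → ℤ) (x : Fin 8) : ℕ := (bzDen a x).toNat

/-- `A` is symmetric (the two adjacency conditions exclude each other). -/
theorem A_symm (a : Fin 8 → ℤ) (x y : Fin 8) : A a x y = A a y x := by
  unfold A
  by_cases h1 : lab y.val = (lab x.val + 1) % 8
  · by_cases h2 : lab x.val = (lab y.val + 1) % 8
    · exfalso; omega
    · rw [if_pos h1, if_neg h2, if_pos h1]
  · by_cases h2 : lab x.val = (lab y.val + 1) % 8
    · rw [if_neg h1, if_pos h2, if_pos h2]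
    · rw [if_neg h1, if_neg h2, if_neg h2, if_neg h1]

/-- **Balance** of the cyclic datum = Brown's homogeneity (5.2) for the Brown–Zudilin exponents (`homogeneous_bz`), on the
cone `bzNum a, bzDen a ≥ 0`. -/
theorem balanced (a : Fin 8 → ℤ) (hA : ∀ i, 0 ≤ bzNum a i) (hB : ∀ i, 0 ≤ bzDen a i) (x : Fin 8) :
    (∑ y : Fin 8, if y = x then 0 else A a x y) = B a (x - 1) + B a x := by
  -- combinatorial part: the two `δ⁰`-edges at the label of `x`
  have hcomb : (∑ y : Fin 8, if y = x then 0 else A a x y) =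
      (bzNum a (pi8dual x - 1)).toNat + (bzNum a (pi8dual x)).toNat := by
    fin_cases x <;> simp [A, lab, Fin.sum_univ_eight, pi8dual] <;> first | rfl | ring
  -- arithmetic part: Brown's homogeneity at the position `x`, on the cone
  rw [hcomb, B, B]
  have hh := homogeneous_bz a x
  zify [Int.toNat_of_nonneg (hA _), Int.toNat_of_nonneg (hB _)]
  exact hh

/-- P2 g6's dual constant term is the gauge with POSITION `7` at infinity (finite positions `0,…,6`, gap `w` = side
`{w, w+1}` with exponent `bzDen a w`; chords `{0,1} ↦ (1,3)`, `{1,2} ↦ (1,6)`, `{2,3} ↦ (2,6)`, `{3,4} ↦ (2,5)`,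
`{6,7} ↦ (0,4)`, `{7,0} ↦ (0,3)` as index pairs). -/
theorem gauge7_eq_dualConstantTerm (a : Fin 8 → ℤ) :
    coeff (gapVec 5 fun t => B a (Fin.ofNat 8 (7 + 1 + t)))
        (endProd 5 fun i j => A a (Fin.ofNat 8 (7 + 1 + i)) (Fin.ofNat 8 (7 + 1 + j))) = dualConstantTerm a := by
  have hgap : (gapVec 5 fun t => B a (Fin.ofNat 8 (7 + 1 + t))) =
      Finsupp.equivFunOnFinite.symm fun w : Fin 6 => (bzDen a (Fin.castLE (by norm_num) w)).toNat := by
    ext w; fin_cases w <;> rfl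
  have htab : (endProd 5 fun i j => A a (Fin.ofNat 8 (7 + 1 + i)) (Fin.ofNat 8 (7 + 1 + j))) =
      endProd 5 (fun i j => if i = 1 ∧ j = 3 then (bzNum a 0).toNat else if i = 1 ∧ j = 6 then (bzNum a 1).toNat
        else if i = 2 ∧ j = 6 then (bzNum a 2).toNat else if i = 2 ∧ j = 5 then (bzNum a 3).toNat
        else if i = 0 ∧ j = 4 then (bzNum a 6).toNat else if i = 0 ∧ j = 3 then (bzNum a 7).toNat else 0) :=
    VIMGauge.endProd_congr _ _ fun i j hi hj hij => by
      interval_cases i <;> interval_cases j <;> first | omega | rfl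
  have hprod : endProd 5 (fun i j => if i = 1 ∧ j = 3 then (bzNum a 0).toNat else if i = 1 ∧ j = 6 then (bzNum a 1).toNat
        else if i = 2 ∧ j = 6 then (bzNum a 2).toNat else if i = 2 ∧ j = 5 then (bzNum a 3).toNat
        else if i = 0 ∧ j = 4 then (bzNum a 6).toNat else if i = 0 ∧ j = 3 then (bzNum a 7).toNat else 0) =
      dualSpanProd fun i => (bzNum a i).toNat := by
    simp [endProd, Finset.prod_range_succ, spanPoly, Fin.sum_univ_six, dualSpanProd]
    ring
  rw [dualConstantTerm, hgap, htab, hprod]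

/-- The dual constant term of `bzSwap a` is the gauge with POSITION `3` at infinity of the SAME configuration (finite
positions `4,5,6,7,0,1,2`; gap `t` = side `{4+t, 5+t}` with exponent `bzDen a (4+t) = bzDen (bzSwap a) t`; the chord
exponents are `bzNum (bzSwap a) = bzNum a ∘ (4,3,2,1,0,7,6,5)` in P2 g6's slots). -/
theorem gauge3_eq_dualConstantTerm_bzSwap (a : Fin 8 → ℤ) :
    coeff (gapVec 5 fun t => B a (Fin.ofNat 8 (3 + 1 + t)))
        (endProd 5 fun i j => A a (Fin.ofNat 8 (3 + 1 + i)) (Fin.ofNat 8 (3 + 1 + j))) =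
      dualConstantTerm (bzSwap a) := by
  have hden : ∀ w : Fin 8, bzDen (bzSwap a) w = bzDen a (4 + w) := fun w => (congrFun (bzDen_bzSwap a) w).symm
  have hnum : ∀ j : Fin 8, bzNum (bzSwap a) j = bzNum a ((![4, 3, 2, 1, 0, 7, 6, 5] : Fin 8 → Fin 8) j) := by
    intro j
    have h1 : bzNum (bzSwap a) j = bzNum a (reflPos j - 1) := (congrFun (bzNum_bzSwap a) j).symm
    have h2 : reflPos j - 1 = (![4, 3, 2, 1, 0, 7, 6, 5] : Fin 8 → Fin 8) j := congrFun reflPos_sub_one_eq j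
    rw [h1, h2]
  have hgap : (gapVec 5 fun t => B a (Fin.ofNat 8 (3 + 1 + t))) =
      Finsupp.equivFunOnFinite.symm fun w : Fin 6 => (bzDen (bzSwap a) (Fin.castLE (by norm_num) w)).toNat := by
    ext w
    simp only [gapVec, Finsupp.coe_equivFunOnFinite_symm, B, hden]
    fin_cases w <;> rfl
  have hA : (fun i => (bzNum (bzSwap a) i).toNat) = fun i => (bzNum a ((![4, 3, 2, 1, 0, 7, 6, 5] : Fin 8 → Fin 8) i)).toNat :=
    funext fun i => by rw [hnum]
  have htab : (endProd 5 fun i j => A a (Fin.ofNat 8 (3 + 1 + i)) (Fin.ofNat 8 (3 + 1 + j))) =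
      endProd 5 (fun i j => if i = 0 ∧ j = 4 then (bzNum a 6).toNat else if i = 1 ∧ j = 3 then (bzNum a 4).toNat
        else if i = 2 ∧ j = 6 then (bzNum a 2).toNat else if i = 0 ∧ j = 3 then (bzNum a 5).toNat
        else if i = 2 ∧ j = 5 then (bzNum a 1).toNat else if i = 1 ∧ j = 6 then (bzNum a 3).toNat else 0) :=
    VIMGauge.endProd_congr _ _ fun i j hi hj hij => by
      interval_cases i <;> interval_cases j <;> first | omega | rfl
  have hprod : endProd 5 (fun i j => if i = 0 ∧ j = 4 then (bzNum a 6).toNat else if i = 1 ∧ j = 3 then (bzNum a 4).toNat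
        else if i = 2 ∧ j = 6 then (bzNum a 2).toNat else if i = 0 ∧ j = 3 then (bzNum a 5).toNat
        else if i = 2 ∧ j = 5 then (bzNum a 1).toNat else if i = 1 ∧ j = 6 then (bzNum a 3).toNat else 0) =
      dualSpanProd fun i => (bzNum a ((![4, 3, 2, 1, 0, 7, 6, 5] : Fin 8 → Fin 8) i)).toNat := by
    simp [endProd, Finset.prod_range_succ, spanPoly, Fin.sum_univ_six, dualSpanProd]
    ring
  rw [dualConstantTerm, hgap, htab, hprod, hA]

/-- **The dual constant term is `bzSwap`-invariant** on the cone `bzNum a, bzDen a ≥ 0` (gauge independence,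
`GapRegime.gaugeCT_eq_gauge_zero`, for the gauges at positions `7` and `3`). -/
theorem dualConstantTerm_bzSwap (a : Fin 8 → ℤ) (hA : ∀ i, 0 ≤ bzNum a i) (hB : ∀ i, 0 ≤ bzDen a i) :
    dualConstantTerm (bzSwap a) = dualConstantTerm a := by
  rw [← gauge7_eq_dualConstantTerm a, ← gauge3_eq_dualConstantTerm_bzSwap a,
    gaugeCT_eq_gauge_zero (M := 5) (A a) (B a) (A_symm a) (balanced a hA hB) 3,
    gaugeCT_eq_gauge_zero (M := 5) (A a) (B a) (A_symm a) (balanced a hA hB) 7]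

/-- `bzSwap` preserves the cone `bzNum, bzDen ≥ 0` (it permutes the exponents). -/
theorem cone_bzSwap (a : Fin 8 → ℤ) (hA : ∀ i, 0 ≤ bzNum a i) (hB : ∀ i, 0 ≤ bzDen a i) :
    (∀ i, 0 ≤ bzNum (bzSwap a) i) ∧ ∀ i, 0 ≤ bzDen (bzSwap a) i := by
  refine ⟨fun j => ?_, fun w => ?_⟩
  · have h1 : bzNum (bzSwap a) j = bzNum a (reflPos j - 1) := (congrFun (bzNum_bzSwap a) j).symm
    rw [h1]; exact hA _
  · rw [← congrFun (bzDen_bzSwap a) w]; exact hB _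

/-- **Brown–Zudilin's leading coefficient is invariant under the hidden involution:** `|Q(bzSwap a)| = |Q(a)|` for every
`a ∈ ℤ⁸` with `bzNum a, bzDen a ≥ 0` (`Q(a) = BrownZudilin2022.QOf a`, [BrownZudilin2022, (17)]; via cert-2 g8's D-exact
theorem `DualR.leadingCoeffIsDualConstantTerm_holds` and `dualConstantTerm_bzSwap`). -/
theorem abs_QOf_bzSwap (a : Fin 8 → ℤ) (hA : ∀ i, 0 ≤ bzNum a i) (hB : ∀ i, 0 ≤ bzDen a i) :
    |BrownZudilin2022.QOf (bzSwap a)| = |BrownZudilin2022.QOf a| := by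
  obtain ⟨hA', hB'⟩ := cone_bzSwap a hA hB
  rw [DualR.leadingCoeffIsDualConstantTerm_holds (bzSwap a) hA' hB', DualR.leadingCoeffIsDualConstantTerm_holds a hA hB,
    dualConstantTerm_bzSwap a hA hB]

end BZSwapCT

end Summit.KontsevichZagierPeriods.Zeta5Search.Families.Cellular
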